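import Mathlib
import Literature.Barriers.ValiantsHypothesis.AlgebraicNaturalProofs
import Literature.Barriers.ValiantsHypothesis.GKSS17NaturalProofsPIT
import Literature.Computability.AlgebraicComplexity.ArithCircuitProofs
import Literature.Computability.AlgebraicComplexity.HomogeneousComponentsComplexity
import Literature.Computability.AlgebraicComplexity.ValiantClasses
import HarnessLib

/-!
# Crux `BarrierLever.DefinableEquations` (stmt-8745) ⟺ `SingleSizeEquations` (stmt-8749) —
# the DEGREE WINDOW: an equation in the degree-`d` coefficients alone is an equation, and the
# window of `SmallCircuits ℂ n b` at a FIXED degree `d` is a class of FORMS of size `≤ (d+2)² n^b`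

The crux asks, for every size exponent `b` (eventually in `n`), for a NONZERO level-`a` Boolean
sum `E = boolSum H` in the `N = C(2n,n)` coefficient variables `c_μ` (`|μ| ≤ n`) vanishing at
`coeff(f)` for every `f` of degree `≤ n` and circuit size `≤ n^b` (`SmallCircuits ℂ n b`).  This
file isolates the cheapest geometric door through which such an `E` can come: let it depend only
on the `C(n+d-1, d)` coordinates `c_μ` with `|μ| = d` for a FIXED degree `d` (the tree's
`GKSS2017.homMonomials n d ⊆ degLEMonomials n`).

* §1 the window variables: `homMonomials n d ⊆ degLEMonomials n` (`d ≤ n`), finiteness.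
* §2 PULLBACK: a polynomial `E'` (or a Boolean-sum datum `H'`) in the window variables pulls back
  along the inclusion `ι_d` (`rename ι_d`) to the `N` coefficient variables with the same
  complexity and degree bounds, the same number `q` of Boolean variables
  (`boolSum (rename (Sum.map ι_d id) H') = rename ι_d (boolSum H')`, tree
  `boolSum_rename_sumMap`), still nonzero, and with `E(coeff f) = E'(coeff_d f)`
  (`eval_rename_inclusion`): `exists_datum_of_windowDatum`.
* §3 FORMS: `coeff_d f = coeff_d (hom_d f)` and `L(hom_d f) ≤ (d+2)² L(f)` (BCS Lemma 21.25, tree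
  `complexity_homogeneousComponent_le_sq_mul`), so a window polynomial vanishing on the class
  `W_d(n, b) = {g : g homogeneous of degree d, L(g) ≤ (d+2)² n^b}` of FORMS vanishes at
  `coeff_d f` for every `f ∈ SmallCircuits ℂ n b` (`window_vanishing_of_forms`).
* §4 THE DOOR AT `b` (no route import): level-`a` Boolean-sum equations for `W_d(n, b)`,
  `d` fixed, eventually in `n`, give the inner statement of `SingleSizeEquations` /
  `DefinableEquations` at `b` (`singleSize_at_of_window_equations`); `q = 0` version in FSV's
  frame (`isNaturalProof_of_window`).  The route-decl corollaries live in the leaf file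
  `…DegreeWindowDoor.lean`; the fact that the window is NOT vacuous (nonzero window equations
  exist as soon as `4 (d+2)² n^b < C(n+d-1, d)`, e.g. `d = b + 1` eventually) is the sibling
  `…DegreeWindowThin.lean`.

WHY THIS DOOR (honest).  In the window the ambient dimension is `C(n+d-1,d) = poly(n)` while the
distinguisher budget `N^a = C(2n,n)^a = 2^{Θ(n)}` stays EXPONENTIAL in `n`; the class `W_d(n,b)` is
the set of degree-`d` forms ONE POWER OF `n` below generic size (`n^b` against
`C(n+d-1,d)/4 ≈ n^{d}/(4·d!)` for `d = b+1`).  So the crux at `b` follows from: "an equation for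
degree-`(b+1)` forms of circuit size `≤ (b+3)² n^b`, computable by Boolean sums of size `2^{O(n)}`"
— at the open rung `b = 2`: CUBIC forms in `n` variables of size `≤ 25 n²`.  WHAT THIS IS NOT: a
sufficient door, not an equivalence; it pins the size exponent against the degree (no argument
that loses polynomial factors in size can open or shut it); no explicit equation is given; the
crux stays OPEN at `b = 2` (Chatterjee–Tengse 2023 §1.3, dir. 2); nothing here bears on crux
14610 or on `VP ≠ VNP`, which is NOT proved.  No definitions, no named facts; standard axioms.

References: Forbes–Shpilka–Volk, Theory Comput. 14 (2018), Def. 1 (the frame);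
Bürgisser–Clausen–Shokrollahi 1997, Lemma (21.25) (homogeneous parts); Grochow–Kumar–Saks–Saraf
2017 §2.1 (degree-`d` meta-variables, tree `GKSS2017.homMonomials`); Bürgisser 2000, Def. 2.5 /
Rem. 2.2 (Boolean sums and renaming).
-/

set_option linter.dupNamespace false

noncomputable section

namespace Summit.ValiantsHypothesis.ValiantsHypothesis.Theorems.BarrierLeverDefinableEquations

open MvPolynomial
open Literature.Computability.AlgebraicComplexity Literature.Barriers.ValiantsHypothesis
open scoped BigOperators

namespace DegreeWindow

/-! ## §1 The window variables -/

/-- Degree-`d` monomials have degree `≤ n` when `d ≤ n`: the window variables are among the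
crux's `N = C(2n,n)` coefficient variables. [folklore] -/
theorem homMonomials_subset_degLE {n d : ℕ} (h : d ≤ n) :
    GKSS2017.homMonomials n d ⊆ degLEMonomials n :=
  fun _ hm => (le_of_eq hm).trans h

/-- The window variables form a finite type. [folklore] -/
theorem finite_homMonomials (n d : ℕ) : Finite (GKSS2017.homMonomials n d) :=
  ((Finsupp.finite_of_degree_le (σ := Fin n) (n := d)).subset
    (fun _ hm => le_of_eq hm)).to_subtype

/-- `#(homMonomials n d) = C(n + d - 1, d)`. [cite: GrochowKumarSaksSaraf2017, §2.1] -/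
theorem natCard_homMonomials (n d : ℕ) :
    Nat.card (GKSS2017.homMonomials n d) = (n + d - 1).choose d := by
  rw [GKSS2017.ncard_homMonomials, Nat.add_comm]

/-! ## §2 Pullback of window polynomials and window Boolean-sum data -/

/-- The coefficient vector on all `N` coordinates restricts to the window coefficient vector
along the inclusion. [folklore] -/
theorem coeffVector_comp_inclusion {n d : ℕ} (h : d ≤ n) (f : MvPolynomial (Fin n) ℂ) :
    coeffVector (degLEMonomials n) f ∘ Set.inclusion (homMonomials_subset_degLE h) =
      coeffVector (GKSS2017.homMonomials n d) f := rfl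

/-- **Pullback evaluates through the window**: `(rename ι_d E')(coeff f) = E'(coeff_d f)`. [folklore] -/
theorem eval_rename_inclusion {n d : ℕ} (h : d ≤ n) (f : MvPolynomial (Fin n) ℂ)
    (E : MvPolynomial (GKSS2017.homMonomials n d) ℂ) :
    eval (coeffVector (degLEMonomials n) f)
        (rename (Set.inclusion (homMonomials_subset_degLE h)) E) =
      eval (coeffVector (GKSS2017.homMonomials n d) f) E := by
  rw [eval_rename, coeffVector_comp_inclusion h]

/-- Pullback does not increase circuit size. [cite: Burgisser2000, Rem. 2.2] -/
theorem complexity_rename_inclusion_le {n d : ℕ} (h : d ≤ n)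
    (E : MvPolynomial (GKSS2017.homMonomials n d) ℂ) :
    complexity (rename (Set.inclusion (homMonomials_subset_degLE h)) E) ≤ complexity E :=
  complexity_rename_le_holds' _ _

/-- Pullback does not increase the degree. [folklore] -/
theorem totalDegree_rename_inclusion_le {n d : ℕ} (h : d ≤ n)
    (E : MvPolynomial (GKSS2017.homMonomials n d) ℂ) :
    (rename (Set.inclusion (homMonomials_subset_degLE h)) E).totalDegree ≤ E.totalDegree :=
  totalDegree_rename_le _ _

/-- Pullback of a nonzero window polynomial is nonzero (the inclusion is injective). [folklore] -/
theorem rename_inclusion_ne_zero {n d : ℕ} (h : d ≤ n)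
    {E : MvPolynomial (GKSS2017.homMonomials n d) ℂ} (hE : E ≠ 0) :
    rename (Set.inclusion (homMonomials_subset_degLE h)) E ≠ 0 := fun h0 =>
  hE (rename_injective _ (Set.inclusion_injective _) (by rw [h0, map_zero]))

/-- **Boolean sums commute with the pullback**: renaming the free (coefficient) variables of the
datum `H'` along `ι_d` and keeping the `q` Boolean variables gives a datum whose Boolean sum is
the pullback of `boolSum H'`. [cite: Burgisser2000, Def. 2.5 and Rem. 2.2] -/
theorem boolSum_rename_window {n d q : ℕ} (h : d ≤ n)
    (H : MvPolynomial (GKSS2017.homMonomials n d ⊕ Fin q) ℂ) :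
    boolSum (rename (Sum.map (Set.inclusion (homMonomials_subset_degLE h)) id) H) =
      rename (Set.inclusion (homMonomials_subset_degLE h)) (boolSum H) :=
  boolSum_rename_sumMap _ _

/-- **Window datum ⇒ datum.** A Boolean-sum datum `H'` in the window variables (complexity and
degree `≤ B`, `q` Boolean variables, `boolSum H' ≠ 0`) pulls back to a datum `H` in the `N`
coefficient variables with the same bounds and the same `q`, `boolSum H ≠ 0`, and
`(boolSum H)(coeff f) = (boolSum H')(coeff_d f)` for every `f`. [cite: ForbesShpilkaVolk2018, Def. 1] -/
theorem exists_datum_of_windowDatum {n d q B : ℕ} (h : d ≤ n)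
    (H' : MvPolynomial (GKSS2017.homMonomials n d ⊕ Fin q) ℂ)
    (hc : complexity H' ≤ B) (hdeg : H'.totalDegree ≤ B) (hne : boolSum H' ≠ 0) :
    ∃ H : MvPolynomial (degLEMonomials n ⊕ Fin q) ℂ,
      complexity H ≤ B ∧ H.totalDegree ≤ B ∧ boolSum H ≠ 0 ∧
      ∀ f : MvPolynomial (Fin n) ℂ,
        eval (coeffVector (degLEMonomials n) f) (boolSum H) =
          eval (coeffVector (GKSS2017.homMonomials n d) f) (boolSum H') := by
  refine ⟨rename (Sum.map (Set.inclusion (homMonomials_subset_degLE h)) id) H',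
    (complexity_rename_le_holds' _ _).trans hc, (totalDegree_rename_le _ _).trans hdeg, ?_, ?_⟩
  · rw [boolSum_rename_window h]
    exact rename_inclusion_ne_zero h hne
  · intro f
    rw [boolSum_rename_window h, eval_rename_inclusion h]

/-! ## §3 The window of `SmallCircuits ℂ n b` is a class of FORMS of small size -/

/-- The degree-`d` coefficients of `f` are those of its degree-`d` homogeneous component. [folklore] -/
theorem coeffVector_homMonomials_eq_homogeneousComponent {n d : ℕ} (f : MvPolynomial (Fin n) ℂ) :
    coeffVector (GKSS2017.homMonomials n d) f =
      coeffVector (GKSS2017.homMonomials n d) (homogeneousComponent d f) := by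
  funext μ
  have hμ : (μ : Fin n →₀ ℕ).degree = d := μ.2
  rw [coeffVector_apply, coeffVector_apply, coeff_homogeneousComponent, if_pos hμ]

/-- **The window of the crux's class consists of forms of size `≤ (d+2)² n^b`**: for
`f ∈ SmallCircuits ℂ n b`, `hom_d f` is homogeneous of degree `d` and has complexity
`≤ (d+2)² n^b`. [cite: BurgisserClausenShokrollahi1997, Lemma (21.25)] -/
theorem homogeneousComponent_mem_forms {n b d : ℕ} {f : MvPolynomial (Fin n) ℂ}
    (hf : f ∈ SmallCircuits ℂ n b) :
    (homogeneousComponent d f).IsHomogeneous d ∧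
      complexity (homogeneousComponent d f) ≤ (d + 2) ^ 2 * n ^ b :=
  ⟨homogeneousComponent_isHomogeneous d f,
    (complexity_homogeneousComponent_le_sq_mul f d).trans (Nat.mul_le_mul_left _ hf.2)⟩

/-- **A window polynomial vanishing on the forms `W_d(n,b)` vanishes on the window of
`SmallCircuits ℂ n b`.** [cite: ForbesShpilkaVolk2018, Def. 1] -/
theorem window_vanishing_of_forms {n b d : ℕ} {E : MvPolynomial (GKSS2017.homMonomials n d) ℂ}
    (hE : ∀ g : MvPolynomial (Fin n) ℂ, g.IsHomogeneous d → complexity g ≤ (d + 2) ^ 2 * n ^ b →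
      eval (coeffVector (GKSS2017.homMonomials n d) g) E = 0) :
    ∀ f ∈ SmallCircuits ℂ n b, eval (coeffVector (GKSS2017.homMonomials n d) f) E = 0 := by
  intro f hf
  obtain ⟨hhom, hc⟩ := homogeneousComponent_mem_forms (d := d) hf
  rw [coeffVector_homMonomials_eq_homogeneousComponent]
  exact hE _ hhom hc

/-! ## §4 The door at the size exponent `b` (inner statement; no route import) -/

/-- **The degree window, `q = 0` (FSV's frame).** A nonzero window polynomial of complexity and
degree `≤ N^a` (`N = C(2n,n)`, `d ≤ n`) vanishing on the forms `W_d(n,b)` pulls back to an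
algebraically natural proof of level `a` against `SmallCircuits ℂ n b`.
[cite: ForbesShpilkaVolk2018, Def. 1] -/
theorem isNaturalProof_of_window {n a b d : ℕ} (h : d ≤ n)
    {E : MvPolynomial (GKSS2017.homMonomials n d) ℂ} (hE0 : E ≠ 0)
    (hc : complexity E ≤ (Nat.choose (2 * n) n) ^ a)
    (hdeg : E.totalDegree ≤ (Nat.choose (2 * n) n) ^ a)
    (hvan : ∀ g : MvPolynomial (Fin n) ℂ, g.IsHomogeneous d → complexity g ≤ (d + 2) ^ 2 * n ^ b →
      eval (coeffVector (GKSS2017.homMonomials n d) g) E = 0) :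
    IsNaturalProof (degLEMonomials n) (SmallCircuits ℂ n b) (Distinguishers ℂ n a)
      (rename (Set.inclusion (homMonomials_subset_degLE h)) E) := by
  refine ⟨⟨(complexity_rename_inclusion_le h E).trans hc,
    (totalDegree_rename_inclusion_le h E).trans hdeg⟩, rename_inclusion_ne_zero h hE0, ?_⟩
  intro f hf
  rw [eval_rename_inclusion h]
  exact window_vanishing_of_forms hvan f hf

/-- **THE DEGREE-WINDOW DOOR at `b`.** If for some FIXED degree `d` there are a level `a` and a
threshold `n₀` such that for all `n ≥ n₀` some level-`a` Boolean-sum datum in the `C(n+d-1,d)`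
window variables (`q ≤ N^a` Boolean variables, complexity and degree `≤ N^a`, `N = C(2n,n)`) has
a NONZERO Boolean sum vanishing at `coeff_d(g)` for every FORM `g` of degree `d` and circuit size
`≤ (d+2)² n^b`, then the inner statement of `SingleSizeEquations` / `DefinableEquations` holds at
`b` (same `a`; threshold `max n₀ d`). [cite: ForbesShpilkaVolk2018, Def. 1] -/
theorem singleSize_at_of_window_equations (b d : ℕ)
    (hE : ∃ a n₀ : ℕ, ∀ n ≥ n₀, ∃ q : ℕ, q ≤ (Nat.choose (2 * n) n) ^ a ∧
      ∃ H' : MvPolynomial (GKSS2017.homMonomials n d ⊕ Fin q) ℂ,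
        complexity H' ≤ (Nat.choose (2 * n) n) ^ a ∧ H'.totalDegree ≤ (Nat.choose (2 * n) n) ^ a ∧
        boolSum H' ≠ 0 ∧
        ∀ g : MvPolynomial (Fin n) ℂ, g.IsHomogeneous d → complexity g ≤ (d + 2) ^ 2 * n ^ b →
          eval (coeffVector (GKSS2017.homMonomials n d) g) (boolSum H') = 0) :
    ∃ a n₀ : ℕ, ∀ n ≥ n₀, ∃ q : ℕ, q ≤ (Nat.choose (2 * n) n) ^ a ∧
      ∃ H : MvPolynomial (↥(degLEMonomials n) ⊕ Fin q) ℂ,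
        complexity H ≤ (Nat.choose (2 * n) n) ^ a ∧ H.totalDegree ≤ (Nat.choose (2 * n) n) ^ a ∧
        boolSum H ≠ 0 ∧
        ∀ f ∈ SmallCircuits ℂ n b, eval (coeffVector (degLEMonomials n) f) (boolSum H) = 0 := by
  obtain ⟨a, n₀, hn₀⟩ := hE
  refine ⟨a, max n₀ d, fun n hn => ?_⟩
  have hdn : d ≤ n := le_of_max_le_right hn
  obtain ⟨q, hq, H', hc, hdeg, hne, hvan⟩ := hn₀ n (le_of_max_le_left hn)
  obtain ⟨H, hHc, hHd, hHne, hHeval⟩ := exists_datum_of_windowDatum hdn H' hc hdeg hne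
  refine ⟨q, hq, H, hHc, hHd, hHne, fun f hf => ?_⟩
  rw [hHeval]
  exact window_vanishing_of_forms hvan f hf

/-- **Uniform version** (one level `a` for every `b`, a degree `d = d(b)` per exponent): the
hypothesis shape of the crux `DefinableEquations` itself. [cite: ForbesShpilkaVolk2018, Def. 1] -/
theorem definable_shape_of_window_equations {a : ℕ}
    (hE : ∀ b : ℕ, ∃ d n₀ : ℕ, ∀ n ≥ n₀, ∃ q : ℕ, q ≤ (Nat.choose (2 * n) n) ^ a ∧
      ∃ H' : MvPolynomial (GKSS2017.homMonomials n d ⊕ Fin q) ℂ,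
        complexity H' ≤ (Nat.choose (2 * n) n) ^ a ∧ H'.totalDegree ≤ (Nat.choose (2 * n) n) ^ a ∧
        boolSum H' ≠ 0 ∧
        ∀ g : MvPolynomial (Fin n) ℂ, g.IsHomogeneous d → complexity g ≤ (d + 2) ^ 2 * n ^ b →
          eval (coeffVector (GKSS2017.homMonomials n d) g) (boolSum H') = 0) :
    ∀ b : ℕ, ∃ n₀ : ℕ, ∀ n ≥ n₀, ∃ q : ℕ, q ≤ (Nat.choose (2 * n) n) ^ a ∧
      ∃ H : MvPolynomial (↥(degLEMonomials n) ⊕ Fin q) ℂ,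
        complexity H ≤ (Nat.choose (2 * n) n) ^ a ∧ H.totalDegree ≤ (Nat.choose (2 * n) n) ^ a ∧
        boolSum H ≠ 0 ∧
        ∀ f ∈ SmallCircuits ℂ n b, eval (coeffVector (degLEMonomials n) f) (boolSum H) = 0 := by
  intro b
  obtain ⟨d, n₀, hn₀⟩ := hE b
  refine ⟨max n₀ d, fun n hn => ?_⟩
  have hdn : d ≤ n := le_of_max_le_right hn
  obtain ⟨q, hq, H', hc, hdeg, hne, hvan⟩ := hn₀ n (le_of_max_le_left hn)
  obtain ⟨H, hHc, hHd, hHne, hHeval⟩ := exists_datum_of_windowDatum hdn H' hc hdeg hne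
  refine ⟨q, hq, H, hHc, hHd, hHne, fun f hf => ?_⟩
  rw [hHeval]
  exact window_vanishing_of_forms hvan f hf

end DegreeWindow

end Summit.ValiantsHypothesis.ValiantsHypothesis.Theorems.BarrierLeverDefinableEquations
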